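import Summits.BirchSwinnertonDyer.BirchSwinnertonDyer.Theses.ErratumRoadFive
import Summits.BirchSwinnertonDyer.BirchSwinnertonDyer.Theorems.ErratumRoadFiveKolyvaginRestTam
import Summits.BirchSwinnertonDyer.BirchSwinnertonDyer.Theorems.ErratumRoadFiveOpenInputRung5835a1
import Summits.BirchSwinnertonDyer.BirchSwinnertonDyer.Theorems.ErratumRoadFiveRest3BranchesDefs
import Summits.BirchSwinnertonDyer.BirchSwinnertonDyer.Theorems.ErratumRoadFiveRest3SlackRungs

/-!
# (v3, planner bsd-stepL-plan g28, 2026-08-27: the two PLAN-ONLY rung stubs R1/R2 are DROPPED — their statements are LANDED BY NAME as the parent's rungs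
#  `Theorems.Rest3Rungs.stub_rung_rest3_5015b1` ∕ `Theorems.Rest3Rungs.stub_rung_rest4_5595f1` (p477401, rest-p2 g2); a by-name copy under (NW) names is refused `dedup.landed`,
#  so the (NW) child's BC5 witness is the landed parent decl BY POINTER; S1/S2 and the composition UNCHANGED from v2 = v1)
# BC3 birth skeleton — crux `ErratumRoadFive.Rest3NoWitnessBranchAtFive` (item stmt-BirchSwinnertonDyer-19703, child (NW) of REST‴ 19624)

Route `route-BirchSwinnertonDyer-ErratumRoadFive` rev 14 (rung K2), cell `bsd-stepL`, planner `bsd-stepL-plan` g25 (2026-08-26):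
the parent REST‴ was SPLIT (gen 1) into (T) `Rest3TorsionBranchAtFive` (19702) and (NW) `Rest3NoWitnessBranchAtFive`
(19703) BY NAME over rest-p2 g0's landed defs (p446621 `Theorems/ErratumRoadFiveRest3BranchesDefs.lean`), glue-by
`Theorems.rest3_of_branches`. This child INHERITS the parent's registered Tamagawa cut (planner g25,
`Cruxes/RamNoErratumDataAtFive` skeleton): (NW) = Locus ⊔ off-Locus, where

* `stub_nw_locus` — (NW) on `p ∤ ∏_ℓ c_ℓ(E)` (cw 680 724 = all-split 531 672 + only-`q = 2` 149 052; rest-p2 census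
  d3fb16a4f3d0ef29): the Kolyvagin road's target modulo ONE preprint input (Skinner–Zhang arXiv:1407.1099 Thm. 1.3 in
  ♯-typing) via imc-p1 g5's `Koly.openInputOnTree_onLocus_of_kolyvaginFramesHL_of_thm331Mult`; typed unconditionally;
* `stub_nw_offLocus` — (NW) on `p ∣ ∏_ℓ c_ℓ(E)` (cw 18 793; `p ∣ c_ℓ` at some `ℓ`, torsion-free at `p`): no supplier;
* BC5 rungs (T3) — NOT stubs of this skeleton any more (v3): the open input at `(5015b1, 5)` ∈ Locus ∩ (NW) and at
  `(5595f1, 5)` ∈ off-Locus ∩ (NW) (`c₃ = 5`; both non-split at 5, hence torsion-free at 5) is PROVED on the Tamagawa-slack road and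
  LANDED BY NAME as the parent REST‴'s rungs `Summit.BirchSwinnertonDyer.BirchSwinnertonDyer.Theorems.Rest3Rungs.stub_rung_rest3_5015b1`
  (`padicValNat 5 index = 0`) and `…Rest3Rungs.stub_rung_rest4_5595f1` (`padicValNat 5 index ≤ 1`) in
  `Theorems/ErratumRoadFiveRest3RungsByName.lean` (p477401; certificates `Theorems.rung_5015b1_d179_of_items_of_slackCert` p475571,
  `Theorems.rung_5595f1_d59_of_items_of_slackCert` p475167). Identical statements cannot land twice (`dedup.landed`), so the (NW)
  child cites them BY POINTER (planner ruling 2026-08-27, on rest-p2 g2's ask).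

`Rest3NoWitnessBranchAtFive_of` = case split on `p ∣ ∏ c_ℓ` (pure logic), concluding the ROUTE DECL by name (which
unfolds to rest-p2's `Theorems.Rest3NoWitnessBranchAtFive`).
[cite: SkinnerZhang2014, Thm. 1.3] [cite: JetchevSkinnerWan2017, Thm. 3.3.1, §7.4] [cite: Castella2018Erratum, Thm. 1.1 (iii)]
[cite: Kolyvagin1990, Thm. A] [cite: Cremona1997, Table 1 (5015b1, 5595f1)]
-/

noncomputable section

open scoped Classical

namespace Summit.BirchSwinnertonDyer.BirchSwinnertonDyer.Cruxes.Rest3NoWitnessBranchAtFive.Birth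

/-! ## Registered stubs -/

/-- **S1 · `stub_nw_locus` — (NW) ON THE LOCUS `p ∤ ∏ c_ℓ`.** The open input `P2OpenInputOnTreeAt W p` at every
(ram) pair, torsion-free at `p`, with no odd non-split ramified witness and `p ∤ ∏_ℓ c_ℓ(E)` (cw 680 724). Reached by the Kolyvagin road
modulo Skinner–Zhang Thm. 1.3 (PREPRINT) via `Koly.openInputOnTree_onLocus_of_kolyvaginFramesHL_of_thm331Mult`;
open unconditionally. [cite: SkinnerZhang2014, Thm. 1.3] [cite: JetchevSkinnerWan2017, Thm. 3.3.1] -/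
theorem stub_nw_locus :
    ∀ (W : WeierstrassCurve ℚ) [W.IsElliptic] [W.IsGloballyMinimal] (p : ℕ) [Fact p.Prime],
      Literature.NumberTheory.EllipticCurves.Rank1Residual.Ram W p →
      (∀ P : (W.baseChange ℚ_[p]).toAffine.Point, p • P = 0 → P = 0) →
      ¬ (∃ (q : ℕ) (_ : Fact q.Prime), q ≠ 2 ∧ q ≠ p ∧ Literature.NumberTheory.EllipticCurves.Rank1Residual.Mult W q ∧
          ¬ W.HasSplitMultiplicativeReductionAtPrime q ∧ ¬ p ∣ padicValInt q W.minimalDiscriminantInt) →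
      ¬ p ∣ W.tamagawaProduct →
      Summit.BirchSwinnertonDyer.Rank1Residual.X11b.P2OpenInputOnTreeAt W p := by
  sorry

/-- **S2 · `stub_nw_offLocus` — (NW) OFF THE LOCUS, `p ∣ ∏ c_ℓ`.** The same open input at every (ram) pair,
torsion-free at `p`, with no odd non-split ramified witness and `p ∣ ∏_ℓ c_ℓ(E)` (cw 18 793 = REST⁗ ∖ (T)). No
printed or announced theorem reaches it.
[cite: Castella2018Erratum, Thm. 1.1 (iii)–(iv)] [cite: JetchevSkinnerWan2017, §7.4] -/
theorem stub_nw_offLocus :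
    ∀ (W : WeierstrassCurve ℚ) [W.IsElliptic] [W.IsGloballyMinimal] (p : ℕ) [Fact p.Prime],
      Literature.NumberTheory.EllipticCurves.Rank1Residual.Ram W p →
      (∀ P : (W.baseChange ℚ_[p]).toAffine.Point, p • P = 0 → P = 0) →
      ¬ (∃ (q : ℕ) (_ : Fact q.Prime), q ≠ 2 ∧ q ≠ p ∧ Literature.NumberTheory.EllipticCurves.Rank1Residual.Mult W q ∧
          ¬ W.HasSplitMultiplicativeReductionAtPrime q ∧ ¬ p ∣ padicValInt q W.minimalDiscriminantInt) →
      p ∣ W.tamagawaProduct →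
      Summit.BirchSwinnertonDyer.Rank1Residual.X11b.P2OpenInputOnTreeAt W p := by
  sorry

/-! ## Stub statements by name -/

namespace Statement

/-- Statement of `stub_nw_locus`. -/
abbrev stub_nw_locus : Prop := type_of% @Birth.stub_nw_locus
/-- Statement of `stub_nw_offLocus`. -/
abbrev stub_nw_offLocus : Prop := type_of% @Birth.stub_nw_offLocus

end Statement

/-! ## The composition (sorry-free): the two regime stub STATEMENTS imply the crux, BY NAME -/

/-- **`Rest3NoWitnessBranchAtFive_of`** — (NW) from its Locus part and its off-Locus part: case split on `p ∣ ∏_ℓ c_ℓ(E)`; the route decl unfolds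
to rest-p2's `Theorems.Rest3NoWitnessBranchAtFive`. Pure logic. -/
theorem Rest3NoWitnessBranchAtFive_of (hL : Statement.stub_nw_locus) (hT : Statement.stub_nw_offLocus) :
    Summit.BirchSwinnertonDyer.BirchSwinnertonDyer.Theses.ErratumRoadFive.Rest3NoWitnessBranchAtFive := by
  intro W _ _ p _ hram htf hnw
  by_cases ht : p ∣ W.tamagawaProduct
  · exact hT W p hram htf hnw ht
  · exact hL W p hram htf hnw ht

/-- The crux along this line, MODULO exactly the two registered regime stubs (sorries live only in `stub_*`). -/
theorem Rest3NoWitnessBranchAtFive_proof :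
    Summit.BirchSwinnertonDyer.BirchSwinnertonDyer.Theses.ErratumRoadFive.Rest3NoWitnessBranchAtFive :=
  Rest3NoWitnessBranchAtFive_of stub_nw_locus stub_nw_offLocus

end Summit.BirchSwinnertonDyer.BirchSwinnertonDyer.Cruxes.Rest3NoWitnessBranchAtFive.Birth

end
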